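import Literature.Analysis.Calculus.LagrangeHessianRealCoercive

/-!
# The implicit family of constrained critical points, III: SYMMETRISATION — from LOCAL conjugation-equivariance to the global equivariance part II asks

Topic `Literature/Analysis/Calculus`; continuation of `ConstrainedCriticalFamily` ∕ `…Real` (same namespace).  Part II (`exists_criticalFamily_real`) takes an action `a` and a constraint
`Φ` that are conjugation-equivariant EVERYWHERE (`a (cE x) = conj (a x)`, `Φ (cE x) = cF (Φ x)` for all `x`).  In the applications the complexified maps are built from LOCAL charts
(logarithms, guarded averages) and are equivariant only NEAR the real base state.  The remedy is elementary and loses nothing: the SYMMETRISATIONS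
`ã x = ½(a x + conj (a (cE x)))`, `Φ̃ x = ½(Φ x + cF (Φ (cE x)))` are equivariant everywhere (conjugations are additive involutions commuting with real scalars), and they COINCIDE
with `a`, `Φ` on the (open) set where these are equivariant — so every local datum of the implicit-function theorem at the base state (class, derivatives, criticality, surjectivity,
nondegeneracy) and every local conclusion transfers by eventual equality.  Characterised POINTWISE (`hã : ∀ x, ã x = …`), no new definition.  Source of the mechanism as in parts I–II
([LuenbergerYe2008] §10.7; [Balaban1985Variational] p. 307 «the equations … are valid for Gᶜ-valued fields», (181) p. 307).

CONTENTS (theorems only; no `def`, no `instance`, no `sorry`).  §8 `symm_equivariant`, `symm_equivariant_scalar` (global equivariance of the symmetrisations); `symm_eq_of_equivariant`,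
`symm_eq_of_equivariant_scalar` (they agree with `Φ`, `a` at every point of equivariance); ★ `symm_eventuallyEq`, `symm_eventuallyEq_scalar` (hence eventually equal near a point of local
equivariance, indeed near every point of the open equivariance set); `contDiffAt_symm_iff`, `fderiv_symm_eq`, `fderiv_fderiv_symm_eq` (+ scalar twins) — the transfers of the
implicit-function data at the base state.  §9 ★ `nondegenerate_of_real` («real NONDEGENERATE on the real kernel ⇒ nondegenerate on the complex kernel», for equivariant `Q`, `L`),
`real_nondegenerate_of_pos` — the EQUIVARIANCE edition of the passage from (β) to `hnondeg`; the POSITIVITY∕SYMMETRY edition and «real onto ⇒ onto» are dag-n12-w2's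
`LagrangeHessianRealCoercive.hnondeg_of_re_pos` ∕ `surjective_of_real_surjective` (landed first, p600811; consumed by name below, not restated).  §10 `fderiv_fderiv_conj_equivariant[_scalar]` (second derivatives of equivariant maps at a real point are
equivariant), ★ `lagrangeHessian_conj_equivariant` (so the Lagrange Hessian at a real critical base with a real multiplier satisfies §9's `hQ`).  §11 `hasDerivAt_fderiv_along_line`, ★ `deriv_deriv_along_lines` (MIXED second derivatives along two real lines of a VECTOR-valued map = the complex Hessian; the first-order line
lemma and the scalar diagonal edition are dag-n12-w2's `hasDerivAt_comp_realLine` ∕ `deriv_deriv_re_comp_realLine`, consumed by name).  §12 `killsKer_of_real` (real tangent-criticality ⇒ complex), `exists_multiplier_of_killsKer` (kills `ker L` + `L` onto ⇒ Lagrange form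
`lam = ℓ₀ ∘ L` — the hypothesis `hcrit`).
-/

noncomputable section

open scoped Topology ContDiff ComplexConjugate
open Set Filter

namespace Literature.Analysis.Calculus.ConstrainedCriticalFamily

open Literature.Analysis.Calculus.LagrangeHessianRealCoercive (hasDerivAt_comp_realLine conj_fix_rePart)

variable {E : Type*} [NormedAddCommGroup E] [NormedSpace ℂ E]
  {F : Type*} [NormedAddCommGroup F] [NormedSpace ℂ F]

/-! ## §8  Symmetrisation -/

section Symm

variable (cE : E →L⋆[ℂ] E) (cF : F →L⋆[ℂ] F)

/-- **THE SYMMETRISED CONSTRAINT IS EQUIVARIANT EVERYWHERE**: for `Φ̃ x = ½(Φ x + cF (Φ (cE x)))` (pointwise) and involutions `cE`, `cF`: `Φ̃ (cE x) = cF (Φ̃ x)`.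
[cite: Balaban1985Variational, p.307 («valid for Gᶜ-valued fields»), (181) p.307] -/
theorem symm_equivariant (hcE : ∀ x, cE (cE x) = x) (hcF : ∀ y, cF (cF y) = y) {Φ Φs : E → F}
    (hΦs : ∀ x, Φs x = (2 : ℂ)⁻¹ • (Φ x + cF (Φ (cE x)))) (x : E) : Φs (cE x) = cF (Φs x) := by
  rw [hΦs, hΦs, hcE, map_smulₛₗ, map_add, hcF, add_comm (cF (Φ x)) (Φ (cE x))]
  congr 1
  rw [map_inv₀, map_ofNat]

/-- **THE SYMMETRISED ACTION IS EQUIVARIANT EVERYWHERE**: for `ã x = ½(a x + conj (a (cE x)))`: `ã (cE x) = conj (ã x)`. [cite: Balaban1985Variational, p.307, (181) p.307] -/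
theorem symm_equivariant_scalar (hcE : ∀ x, cE (cE x) = x) {a as : E → ℂ}
    (has : ∀ x, as x = (2 : ℂ)⁻¹ * (a x + conj (a (cE x)))) (x : E) : as (cE x) = conj (as x) := by
  rw [has, has, hcE, map_mul, map_add, Complex.conj_conj, add_comm (a (cE x))]
  congr 1
  rw [map_inv₀, map_ofNat]

/-- At a point where `Φ` is equivariant the symmetrisation agrees with `Φ`. [cite: Balaban1985Variational, p.307 (bookkeeping)] -/
theorem symm_eq_of_equivariant (hcF : ∀ y, cF (cF y) = y) {Φ Φs : E → F}
    (hΦs : ∀ x, Φs x = (2 : ℂ)⁻¹ • (Φ x + cF (Φ (cE x)))) {x : E} (hx : Φ (cE x) = cF (Φ x)) : Φs x = Φ x := by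
  rw [hΦs, hx, hcF, ← two_smul ℂ (Φ x), smul_smul]
  norm_num

/-- At a point where `a` is equivariant the symmetrisation agrees with `a`. [cite: Balaban1985Variational, p.307 (bookkeeping)] -/
theorem symm_eq_of_equivariant_scalar {a as : E → ℂ}
    (has : ∀ x, as x = (2 : ℂ)⁻¹ * (a x + conj (a (cE x)))) {x : E} (hx : a (cE x) = conj (a x)) : as x = a x := by
  rw [has, hx, Complex.conj_conj, ← two_mul, ← mul_assoc]
  norm_num

/-- ★ **NEAR A POINT OF LOCAL EQUIVARIANCE THE SYMMETRISATION IS EVENTUALLY EQUAL TO `Φ`** (so class, derivatives of every order and every local statement transfer).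
[cite: Balaban1985Variational, p.307, (181) p.307; LuenbergerYe2008, §10.7 pp.306–307] -/
theorem symm_eventuallyEq (hcF : ∀ y, cF (cF y) = y) {Φ Φs : E → F}
    (hΦs : ∀ x, Φs x = (2 : ℂ)⁻¹ • (Φ x + cF (Φ (cE x)))) {x₀ : E} (hloc : ∀ᶠ x in 𝓝 x₀, Φ (cE x) = cF (Φ x)) :
    Φs =ᶠ[𝓝 x₀] Φ := by
  filter_upwards [hloc] with x hx using symm_eq_of_equivariant cE cF hcF hΦs hx

/-- ★ Scalar twin of `symm_eventuallyEq`. [cite: Balaban1985Variational, p.307, (181) p.307] -/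
theorem symm_eventuallyEq_scalar {a as : E → ℂ}
    (has : ∀ x, as x = (2 : ℂ)⁻¹ * (a x + conj (a (cE x)))) {x₀ : E} (hloc : ∀ᶠ x in 𝓝 x₀, a (cE x) = conj (a x)) :
    as =ᶠ[𝓝 x₀] a := by
  filter_upwards [hloc] with x hx using symm_eq_of_equivariant_scalar cE has hx

/-- The equivariance set is open «in the filter sense»: local equivariance near `x₀` gives local equivariance near every point near `x₀` (so the eventual equalities above hold
near all those points too). [cite: Balaban1985Variational, p.307 (bookkeeping)] -/
theorem eventually_eventually_equivariant {Φ : E → F} {x₀ : E} (hloc : ∀ᶠ x in 𝓝 x₀, Φ (cE x) = cF (Φ x)) :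
    ∀ᶠ x in 𝓝 x₀, ∀ᶠ y in 𝓝 x, Φ (cE y) = cF (Φ y) :=
  hloc.eventually_nhds

/-- **CLASS TRANSFER** at a point of local equivariance. [cite: LuenbergerYe2008, §10.7 pp.306–307 (bookkeeping)] -/
theorem contDiffAt_symm_iff (hcF : ∀ y, cF (cF y) = y) {Φ Φs : E → F}
    (hΦs : ∀ x, Φs x = (2 : ℂ)⁻¹ • (Φ x + cF (Φ (cE x)))) {x₀ : E} (hloc : ∀ᶠ x in 𝓝 x₀, Φ (cE x) = cF (Φ x)) {n : WithTop ℕ∞} :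
    ContDiffAt ℂ n Φs x₀ ↔ ContDiffAt ℂ n Φ x₀ :=
  ⟨fun h => h.congr_of_eventuallyEq (symm_eventuallyEq cE cF hcF hΦs hloc).symm,
    fun h => h.congr_of_eventuallyEq (symm_eventuallyEq cE cF hcF hΦs hloc)⟩

/-- **FIRST-DERIVATIVE TRANSFER** at a point of local equivariance. [cite: LuenbergerYe2008, §10.7 pp.306–307 (bookkeeping)] -/
theorem fderiv_symm_eq (hcF : ∀ y, cF (cF y) = y) {Φ Φs : E → F}
    (hΦs : ∀ x, Φs x = (2 : ℂ)⁻¹ • (Φ x + cF (Φ (cE x)))) {x₀ : E} (hloc : ∀ᶠ x in 𝓝 x₀, Φ (cE x) = cF (Φ x)) :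
    fderiv ℂ Φs x₀ = fderiv ℂ Φ x₀ :=
  (symm_eventuallyEq cE cF hcF hΦs hloc).fderiv_eq

/-- **SECOND-DERIVATIVE TRANSFER** at a point of local equivariance (the derivatives agree NEAR `x₀`, hence their derivatives at `x₀` agree). [cite: LuenbergerYe2008, §10.7 pp.306–307 (bookkeeping)] -/
theorem fderiv_fderiv_symm_eq (hcF : ∀ y, cF (cF y) = y) {Φ Φs : E → F}
    (hΦs : ∀ x, Φs x = (2 : ℂ)⁻¹ • (Φ x + cF (Φ (cE x)))) {x₀ : E} (hloc : ∀ᶠ x in 𝓝 x₀, Φ (cE x) = cF (Φ x)) :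
    fderiv ℂ (fderiv ℂ Φs) x₀ = fderiv ℂ (fderiv ℂ Φ) x₀ :=
  (symm_eventuallyEq cE cF hcF hΦs hloc).fderiv.fderiv_eq

/-- Scalar class transfer. [cite: LuenbergerYe2008, §10.7 pp.306–307 (bookkeeping)] -/
theorem contDiffAt_symm_iff_scalar {a as : E → ℂ}
    (has : ∀ x, as x = (2 : ℂ)⁻¹ * (a x + conj (a (cE x)))) {x₀ : E} (hloc : ∀ᶠ x in 𝓝 x₀, a (cE x) = conj (a x)) {n : WithTop ℕ∞} :
    ContDiffAt ℂ n as x₀ ↔ ContDiffAt ℂ n a x₀ :=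
  ⟨fun h => h.congr_of_eventuallyEq (symm_eventuallyEq_scalar cE has hloc).symm,
    fun h => h.congr_of_eventuallyEq (symm_eventuallyEq_scalar cE has hloc)⟩

/-- Scalar first-derivative transfer. [cite: LuenbergerYe2008, §10.7 pp.306–307 (bookkeeping)] -/
theorem fderiv_symm_eq_scalar {a as : E → ℂ}
    (has : ∀ x, as x = (2 : ℂ)⁻¹ * (a x + conj (a (cE x)))) {x₀ : E} (hloc : ∀ᶠ x in 𝓝 x₀, a (cE x) = conj (a x)) :
    fderiv ℂ as x₀ = fderiv ℂ a x₀ :=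
  (symm_eventuallyEq_scalar cE has hloc).fderiv_eq

/-- Scalar second-derivative transfer. [cite: LuenbergerYe2008, §10.7 pp.306–307 (bookkeeping)] -/
theorem fderiv_fderiv_symm_eq_scalar {a as : E → ℂ}
    (has : ∀ x, as x = (2 : ℂ)⁻¹ * (a x + conj (a (cE x)))) {x₀ : E} (hloc : ∀ᶠ x in 𝓝 x₀, a (cE x) = conj (a x)) :
    fderiv ℂ (fderiv ℂ as) x₀ = fderiv ℂ (fderiv ℂ a) x₀ :=
  (symm_eventuallyEq_scalar cE has hloc).fderiv.fderiv_eq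

/-- ★ **EVENTUAL EQUALITY OF THE DERIVATIVE MAPS** near a point of local equivariance (what the transfer of the Lagrange identity `Da = μ ∘ DΦ` at NEARBY states needs).
[cite: LuenbergerYe2008, §10.7 pp.306–307 (bookkeeping)] -/
theorem fderiv_symm_eventuallyEq (hcF : ∀ y, cF (cF y) = y) {Φ Φs : E → F}
    (hΦs : ∀ x, Φs x = (2 : ℂ)⁻¹ • (Φ x + cF (Φ (cE x)))) {x₀ : E} (hloc : ∀ᶠ x in 𝓝 x₀, Φ (cE x) = cF (Φ x)) :
    fderiv ℂ Φs =ᶠ[𝓝 x₀] fderiv ℂ Φ :=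
  (symm_eventuallyEq cE cF hcF hΦs hloc).fderiv

/-- Scalar twin of `fderiv_symm_eventuallyEq`. [cite: LuenbergerYe2008, §10.7 pp.306–307 (bookkeeping)] -/
theorem fderiv_symm_eventuallyEq_scalar {a as : E → ℂ}
    (has : ∀ x, as x = (2 : ℂ)⁻¹ * (a x + conj (a (cE x)))) {x₀ : E} (hloc : ∀ᶠ x in 𝓝 x₀, a (cE x) = conj (a x)) :
    fderiv ℂ as =ᶠ[𝓝 x₀] fderiv ℂ a :=
  (symm_eventuallyEq_scalar cE has hloc).fderiv

end Symm

/-! ## §9  From REAL data to the COMPLEX hypotheses: «real nondegenerate on the real kernel ⇒ nondegenerate on the complex kernel» (equivariance edition; the positivity ∕ symmetry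
edition and «real onto ⇒ onto» are `LagrangeHessianRealCoercive`, dag-n12-w2)

The letters (β) (positivity of the Lagrange Hessian) and «DΦ onto» are proved in REAL coordinates; the complex implicit-function theorem asks them over `ℂ`.  For
conjugation-equivariant data the passage is linear algebra: split a complex kernel vector into its conjugation-fixed and anti-fixed parts. -/

section RealToComplex

variable (cE : E →L⋆[ℂ] E) (cF : F →L⋆[ℂ] F)

/-- The anti-fixed part `½(s − cE s)` is anti-fixed. [cite: Balaban1985Variational, p.307 (bookkeeping)] -/
theorem antifixed_half_sub (hcE : ∀ x, cE (cE x) = x) (s : E) : cE ((2 : ℂ)⁻¹ • (s - cE s)) = -((2 : ℂ)⁻¹ • (s - cE s)) := by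
  rw [map_smulₛₗ, map_sub, hcE, map_inv₀, map_ofNat, ← smul_neg, neg_sub]

/-- `s = ½(s + cE s) + ½(s − cE s)`. [cite: Balaban1985Variational, p.307 (bookkeeping)] -/
theorem half_add_add_half_sub (s : E) : (2 : ℂ)⁻¹ • (s + cE s) + (2 : ℂ)⁻¹ • (s - cE s) = s := by
  rw [← smul_add, add_add_sub_cancel, ← two_smul ℂ s, smul_smul]
  norm_num

/-- `I •` an anti-fixed vector is fixed. [cite: Balaban1985Variational, p.307 (bookkeeping)] -/
theorem fixed_I_smul_of_antifixed {w : E} (hw : cE w = -w) : cE ((Complex.I : ℂ) • w) = (Complex.I : ℂ) • w := by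
  rw [map_smulₛₗ, hw, starRingEnd_apply, Complex.star_def, Complex.conj_I, neg_smul_neg]

/-- ★ **REAL NONDEGENERACY ON THE REAL KERNEL ⇒ COMPLEX NONDEGENERACY ON THE COMPLEX KERNEL.**  `Q` a ℂ-bilinear form and `L` a ℂ-linear map, both conjugation-EQUIVARIANT
(`Q (cE s) (cE t) = conj (Q s t)`, `L (cE s) = cF (L s)`); if `Q` is nondegenerate on the REAL kernel `{u | cE u = u, L u = 0}` (tested against real kernel vectors), then it is
nondegenerate on the complex kernel `ker L` — the hypothesis `hnondeg` of the complex implicit-function theorem from the real letter (β).  Proof: split `s = u + w` into fixed and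
anti-fixed parts (both in `ker L`); against a real `t`, `Q u t` is real and `Q w t` is imaginary, so both vanish; `u = 0` directly and `w = 0` through the fixed vector `I • w`.
[cite: Balaban1985Variational, p.307 («valid for Gᶜ-valued fields»); LuenbergerYe2008, §10.7 pp.306–307] -/
theorem nondegenerate_of_real (hcE : ∀ x, cE (cE x) = x) (Q : E →L[ℂ] E →L[ℂ] ℂ) (L : E →L[ℂ] F)
    (hQ : ∀ s t, Q (cE s) (cE t) = conj (Q s t)) (hL : ∀ s, L (cE s) = cF (L s))
    (hreal : ∀ u : E, cE u = u → L u = 0 → (∀ t : E, cE t = t → L t = 0 → Q u t = 0) → u = 0) :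
    ∀ s : E, L s = 0 → (∀ t : E, L t = 0 → Q s t = 0) → s = 0 := by
  intro s hs hst
  set u : E := (2 : ℂ)⁻¹ • (s + cE s) with hu
  set w : E := (2 : ℂ)⁻¹ • (s - cE s) with hw
  have hcs : L (cE s) = 0 := by rw [hL, hs, map_zero]
  have huK : L u = 0 := by rw [hu, map_smul, map_add, hs, hcs, add_zero, smul_zero]
  have hwK : L w = 0 := by rw [hw, map_smul, map_sub, hs, hcs, sub_zero, smul_zero]
  have hufix : cE u = u := conj_fix_rePart cE hcE s
  have hwanti : cE w = -w := antifixed_half_sub cE hcE s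
  have hsum : u + w = s := half_add_add_half_sub cE s
  -- against a real kernel vector `t`: `Q u t` real, `Q w t` imaginary, sum zero ⇒ both zero
  have hparts : ∀ t : E, cE t = t → L t = 0 → Q u t = 0 ∧ Q w t = 0 := by
    intro t ht hLt
    have h0 : Q u t + Q w t = 0 := by rw [← add_apply, ← map_add, hsum]; exact hst t hLt
    have hur : conj (Q u t) = Q u t := by rw [← hQ, hufix, ht]
    have hwi : conj (Q w t) = -Q w t := by rw [← hQ, hwanti, ht, map_neg, neg_apply]
    have h1 : Q u t - Q w t = 0 := by
      have := congrArg conj h0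
      rwa [map_add, hur, hwi, map_zero, ← sub_eq_add_neg] at this
    constructor
    · linear_combination (h0 + h1) / 2
    · linear_combination (h0 - h1) / 2
  have hu0 : u = 0 := hreal u hufix huK fun t ht hLt => (hparts t ht hLt).1
  have hIw : cE ((Complex.I : ℂ) • w) = (Complex.I : ℂ) • w := fixed_I_smul_of_antifixed cE hwanti
  have hIwK : L ((Complex.I : ℂ) • w) = 0 := by rw [map_smul, hwK, smul_zero]
  have hIw0 : (Complex.I : ℂ) • w = 0 :=
    hreal _ hIw hIwK fun t ht hLt => by rw [map_smul, smul_apply, (hparts t ht hLt).2, smul_zero]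
  have hw0 : w = 0 := by
    rcases smul_eq_zero.1 hIw0 with h | h
    · exact absurd h Complex.I_ne_zero
    · exact h
  rw [← hsum, hu0, hw0, add_zero]

/-- **POSITIVITY ON THE REAL KERNEL ⇒ REAL NONDEGENERACY** (the usual shape of (β): `Re Q(u,u) > 0` for real kernel vectors `u ≠ 0`). [cite: LuenbergerYe2008, §10.7 pp.306–307 (second-order sufficiency); Balaban1989LargeFieldII, (1.9) p.358] -/
theorem real_nondegenerate_of_pos (Q : E →L[ℂ] E →L[ℂ] ℂ) (L : E →L[ℂ] F)
    (hpos : ∀ u : E, cE u = u → L u = 0 → u ≠ 0 → 0 < (Q u u).re) :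
    ∀ u : E, cE u = u → L u = 0 → (∀ t : E, cE t = t → L t = 0 → Q u t = 0) → u = 0 := by
  intro u hu hLu h
  by_contra hne
  have h0 := h u hu hLu
  have := hpos u hu hLu hne
  rw [h0, Complex.zero_re] at this
  exact lt_irrefl _ this

end RealToComplex

/-! ## §10  Second derivatives of equivariant maps at a real point are equivariant (so the Lagrange Hessian `Q` of §9 IS equivariant), and derivatives along real lines -/

section SecondDeriv

variable (cE : E →L⋆[ℂ] E) (cF : F →L⋆[ℂ] F)

/-- **THE SECOND DERIVATIVE OF AN EQUIVARIANT SCALAR MAP AT A REAL POINT IS CONJUGATION-EQUIVARIANT**: `a ∘ cE = conj ∘ a`, `cE x₀ = x₀`, `a` of class `C²` at `x₀` ⇒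
`D²a(x₀)(cE s)(cE t) = conj (D²a(x₀) s t)` (differentiate `x ↦ Da(x) t`, which satisfies `Da(cE x)(cE t) = conj (Da(x) t)` near `x₀`, through `HasFDerivAt.comp_semilinear`).
[cite: Balaban1985Variational, p.307 («valid for Gᶜ-valued fields»), (181) p.307; LuenbergerYe2008, §10.7 pp.306–307] -/
theorem fderiv_fderiv_conj_equivariant_scalar (hcE : ∀ x, cE (cE x) = x) {a : E → ℂ} (ha : ∀ x, a (cE x) = conj (a x))
    {x₀ : E} (hx₀ : cE x₀ = x₀) {n : WithTop ℕ∞} (hn : 2 ≤ n) (hd : ContDiffAt ℂ n a x₀) (s t : E) :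
    fderiv ℂ (fderiv ℂ a) x₀ (cE s) (cE t) = conj (fderiv ℂ (fderiv ℂ a) x₀ s t) := by
  -- differentiability of `a` near `x₀` and of `Da` at `x₀`
  have h1 : (1 : WithTop ℕ∞) ≤ n := le_trans (by norm_num) hn
  have hda : ∀ᶠ x in 𝓝 x₀, DifferentiableAt ℂ a x := by
    obtain ⟨a', u, hu, -, hua⟩ := contDiffAt_one_iff.1 (hd.of_le h1)
    filter_upwards [hu] with x hx using (hua x hx).differentiableAt
  have hDa : DifferentiableAt ℂ (fderiv ℂ a) x₀ :=
    (hd.fderiv_right (m := 1) (by rw [one_add_one_eq_two]; exact hn)).differentiableAt one_ne_zero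
  -- the map `h_t : x ↦ Da(x) t` and its conjugate partner `h_{cE t} = conj ∘ h_t ∘ cE` near `x₀`
  have hrel : ∀ᶠ x in 𝓝 x₀, fderiv ℂ a x (cE t) = ((starL ℂ : ℂ ≃L⋆[ℂ] ℂ).toContinuousLinearMap ∘ (fun x => fderiv ℂ a x t) ∘ cE) x := by
    have hda' : ∀ᶠ x in 𝓝 x₀, DifferentiableAt ℂ a (cE x) := by
      have ht : Tendsto cE (𝓝 x₀) (𝓝 x₀) := by
        have h := cE.continuous.continuousAt.tendsto (x := x₀); rwa [hx₀] at h
      exact ht.eventually hda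
    filter_upwards [hda'] with x hx
    have h := fderiv_conj_of_equivariant_scalar cE hcE ha hx
    rw [hcE] at h
    rw [h]
    simp [hcE]
  -- derivative of `h_t` at `x₀`: `s ↦ D²a(x₀) s t`
  have hht : HasFDerivAt (fun x => fderiv ℂ a x t) ((ContinuousLinearMap.apply ℂ ℂ t).comp (fderiv ℂ (fderiv ℂ a) x₀)) x₀ :=
    (ContinuousLinearMap.apply ℂ ℂ t).hasFDerivAt.comp x₀ hDa.hasFDerivAt
  -- derivative of `conj ∘ h_t ∘ cE` at `x₀` (`cE x₀ = x₀`)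
  have hx : HasFDerivAt (fun x => fderiv ℂ a x t) ((ContinuousLinearMap.apply ℂ ℂ t).comp (fderiv ℂ (fderiv ℂ a) x₀)) (cE x₀) := by
    rw [hx₀]; exact hht
  have hcomp := hx.comp_semilinear (starL ℂ : ℂ ≃L⋆[ℂ] ℂ).toContinuousLinearMap cE
  -- the derivative of `x ↦ Da(x)(cE t)` at `x₀` in two ways
  have hct : HasFDerivAt (fun x => fderiv ℂ a x (cE t)) ((ContinuousLinearMap.apply ℂ ℂ (cE t)).comp (fderiv ℂ (fderiv ℂ a) x₀)) x₀ :=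
    (ContinuousLinearMap.apply ℂ ℂ (cE t)).hasFDerivAt.comp x₀ hDa.hasFDerivAt
  have heq := (hcomp.congr_of_eventuallyEq hrel).unique hct
  have h := congrArg (fun φ : E →L[ℂ] ℂ => φ (cE s)) heq
  simp only [ContinuousLinearMap.coe_comp, Function.comp_apply, ContinuousLinearEquiv.coe_coe, ContinuousLinearMap.apply_apply, hcE,
    starL_apply, Complex.star_def] at h
  exact h.symm

/-- **THE SECOND DERIVATIVE OF AN EQUIVARIANT VECTOR MAP AT A REAL POINT IS EQUIVARIANT**: `Φ ∘ cE = cF ∘ Φ`, `cE x₀ = x₀`, `Φ` of class `C²` at `x₀` ⇒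
`D²Φ(x₀)(cE s)(cE t) = cF (D²Φ(x₀) s t)`. [cite: Balaban1985Variational, p.307, (181) p.307; LuenbergerYe2008, §10.7 pp.306–307] -/
theorem fderiv_fderiv_conj_equivariant (hcE : ∀ x, cE (cE x) = x) (hcF : ∀ y, cF (cF y) = y) {Φ : E → F} (hΦ : ∀ x, Φ (cE x) = cF (Φ x))
    {x₀ : E} (hx₀ : cE x₀ = x₀) {n : WithTop ℕ∞} (hn : 2 ≤ n) (hd : ContDiffAt ℂ n Φ x₀) (s t : E) :
    fderiv ℂ (fderiv ℂ Φ) x₀ (cE s) (cE t) = cF (fderiv ℂ (fderiv ℂ Φ) x₀ s t) := by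
  have h1 : (1 : WithTop ℕ∞) ≤ n := le_trans (by norm_num) hn
  have hdΦ : ∀ᶠ x in 𝓝 x₀, DifferentiableAt ℂ Φ x := by
    obtain ⟨Φ', u, hu, -, huΦ⟩ := contDiffAt_one_iff.1 (hd.of_le h1)
    filter_upwards [hu] with x hx using (huΦ x hx).differentiableAt
  have hDΦ : DifferentiableAt ℂ (fderiv ℂ Φ) x₀ :=
    (hd.fderiv_right (m := 1) (by rw [one_add_one_eq_two]; exact hn)).differentiableAt one_ne_zero
  have hrel : ∀ᶠ x in 𝓝 x₀, fderiv ℂ Φ x (cE t) = (cF ∘ (fun x => fderiv ℂ Φ x t) ∘ cE) x := by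
    have hdΦ' : ∀ᶠ x in 𝓝 x₀, DifferentiableAt ℂ Φ (cE x) := by
      have ht : Tendsto cE (𝓝 x₀) (𝓝 x₀) := by
        have h := cE.continuous.continuousAt.tendsto (x := x₀); rwa [hx₀] at h
      exact ht.eventually hdΦ
    filter_upwards [hdΦ'] with x hx
    have h := fderiv_conj_of_equivariant cE cF hcE hcF hΦ hx
    rw [hcE] at h
    rw [h]
    simp [hcE]
  have hht : HasFDerivAt (fun x => fderiv ℂ Φ x t) ((ContinuousLinearMap.apply ℂ F t).comp (fderiv ℂ (fderiv ℂ Φ) x₀)) x₀ :=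
    (ContinuousLinearMap.apply ℂ F t).hasFDerivAt.comp x₀ hDΦ.hasFDerivAt
  have hx : HasFDerivAt (fun x => fderiv ℂ Φ x t) ((ContinuousLinearMap.apply ℂ F t).comp (fderiv ℂ (fderiv ℂ Φ) x₀)) (cE x₀) := by
    rw [hx₀]; exact hht
  have hcomp := hx.comp_semilinear cF cE
  have hct : HasFDerivAt (fun x => fderiv ℂ Φ x (cE t)) ((ContinuousLinearMap.apply ℂ F (cE t)).comp (fderiv ℂ (fderiv ℂ Φ) x₀)) x₀ :=
    (ContinuousLinearMap.apply ℂ F (cE t)).hasFDerivAt.comp x₀ hDΦ.hasFDerivAt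
  have heq := (hcomp.congr_of_eventuallyEq hrel).unique hct
  have h := congrArg (fun φ : E →L[ℂ] F => φ (cE s)) heq
  simp only [ContinuousLinearMap.coe_comp, Function.comp_apply, ContinuousLinearMap.apply_apply, hcE] at h
  exact h.symm

/-- ★ **THE LAGRANGE HESSIAN AT A REAL CRITICAL BASE IS CONJUGATION-EQUIVARIANT** (the hypothesis `hQ` of `nondegenerate_of_real`): with `a`, `Φ` equivariant of class `C²` at the real
`x₀` and a REAL multiplier (`conj (ℓ₀ (cF y)) = ℓ₀ y`), `Q(cE s)(cE t) = conj (Q s t)` for `Q s t = D²a(x₀) s t − ℓ₀ (D²Φ(x₀) s t)`. [cite: Balaban1985Variational, p.307, (181) p.307; LuenbergerYe2008, §10.7 pp.306–307] -/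
theorem lagrangeHessian_conj_equivariant (hcE : ∀ x, cE (cE x) = x) (hcF : ∀ y, cF (cF y) = y) {a : E → ℂ} {Φ : E → F}
    (ha : ∀ x, a (cE x) = conj (a x)) (hΦ : ∀ x, Φ (cE x) = cF (Φ x)) {x₀ : E} (hx₀ : cE x₀ = x₀) {n : WithTop ℕ∞} (hn : 2 ≤ n)
    (hda : ContDiffAt ℂ n a x₀) (hdΦ : ContDiffAt ℂ n Φ x₀) {ℓ₀ : F →L[ℂ] ℂ} (hℓ₀ : ∀ y, conj (ℓ₀ (cF y)) = ℓ₀ y)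
    {Q : E →L[ℂ] E →L[ℂ] ℂ} (hQdef : ∀ s t, Q s t = fderiv ℂ (fderiv ℂ a) x₀ s t - ℓ₀ (fderiv ℂ (fderiv ℂ Φ) x₀ s t)) (s t : E) :
    Q (cE s) (cE t) = conj (Q s t) := by
  rw [hQdef, hQdef, fderiv_fderiv_conj_equivariant_scalar cE hcE ha hx₀ hn hda, fderiv_fderiv_conj_equivariant cE cF hcE hcF hΦ hx₀ hn hdΦ, map_sub]
  congr 1
  have h := hℓ₀ (fderiv ℂ (fderiv ℂ Φ) x₀ s t)
  rw [← h, Complex.conj_conj]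

end SecondDeriv

/-! ## §11  Derivatives along real lines (the bridge to the `deriv`-along-a-curve letters of the real second variation) -/

section RealLines

variable {W : Type*} [NormedAddCommGroup W] [NormedSpace ℂ W]

/-- **SECOND DERIVATIVE ALONG TWO LINES**: for `f` of class `C²` at `x`, `t ↦ Df(x + t • v) u` has derivative `D²f(x) v u` at `0`. [cite: LuenbergerYe2008, §10.7 pp.306–307 (bookkeeping); Balaban1989LargeFieldII, (1.12) p.359] -/
theorem hasDerivAt_fderiv_along_line {f : E → W} {x : E} {n : WithTop ℕ∞} (hn : 2 ≤ n) (hf : ContDiffAt ℂ n f x) (u v : E) :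
    HasDerivAt (fun t : ℝ => fderiv ℂ f (x + (t : ℂ) • v) u) (fderiv ℂ (fderiv ℂ f) x v u) 0 := by
  have hDf : DifferentiableAt ℂ (fderiv ℂ f) x :=
    (hf.fderiv_right (m := 1) (by rw [one_add_one_eq_two]; exact hn)).differentiableAt one_ne_zero
  have hg : DifferentiableAt ℂ (fun y => fderiv ℂ f y u) x := (ContinuousLinearMap.apply ℂ W u).differentiableAt.comp x hDf
  have h := hasDerivAt_comp_realLine (x₀ := x) v hg
  have hfd : fderiv ℂ (fun y => fderiv ℂ f y u) x v = fderiv ℂ (fderiv ℂ f) x v u := by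
    rw [show (fun y => fderiv ℂ f y u) = (ContinuousLinearMap.apply ℂ W u) ∘ fderiv ℂ f from rfl,
      fderiv_comp x (ContinuousLinearMap.apply ℂ W u).differentiableAt hDf, (ContinuousLinearMap.apply ℂ W u).fderiv]
    rfl
  rw [hfd] at h
  exact h

/-- ★ **THE MIXED SECOND DERIVATIVE ALONG REAL PARAMETERS IS THE COMPLEX HESSIAN**: for `f` of class `C²` at `x`,
`deriv (t ↦ deriv (s ↦ f (x + s • u + t • v)) 0) 0 = D²f(x) v u` — the currency in which the real second-variation letters are written (`deriv (deriv …)` along chart lines).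
[cite: Balaban1989LargeFieldII, (1.12) p.359; LuenbergerYe2008, §10.7 pp.306–307] -/
theorem deriv_deriv_along_lines {f : E → W} {x : E} {n : WithTop ℕ∞} (hn : 2 ≤ n) (hf : ContDiffAt ℂ n f x) (u v : E) :
    deriv (fun t : ℝ => deriv (fun s : ℝ => f (x + (s : ℂ) • u + (t : ℂ) • v)) 0) 0 = fderiv ℂ (fderiv ℂ f) x v u := by
  have h1 : (1 : WithTop ℕ∞) ≤ n := le_trans (by norm_num) hn
  -- `f` is differentiable near `x`, hence at `x + t • v` for `t` near `0`
  have hdf : ∀ᶠ y in 𝓝 x, DifferentiableAt ℂ f y := by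
    obtain ⟨f', w, hw, -, hwf⟩ := contDiffAt_one_iff.1 (hf.of_le h1)
    filter_upwards [hw] with y hy using (hwf y hy).differentiableAt
  have hγ : Tendsto (fun t : ℝ => x + (t : ℂ) • v) (𝓝 0) (𝓝 x) := by
    have hc : Continuous (fun t : ℝ => x + (t : ℂ) • v) := continuous_const.add (Complex.continuous_ofReal.smul continuous_const)
    have h := hc.continuousAt.tendsto (x := (0 : ℝ))
    rwa [Complex.ofReal_zero, zero_smul, add_zero] at h
  -- the inner derivative, for `t` near `0`
  have hinner : ∀ᶠ t : ℝ in 𝓝 0, deriv (fun s : ℝ => f (x + (s : ℂ) • u + (t : ℂ) • v)) 0 = fderiv ℂ f (x + (t : ℂ) • v) u := by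
    filter_upwards [hγ.eventually hdf] with t ht
    have h := hasDerivAt_comp_realLine (x₀ := x + (t : ℂ) • v) u ht
    have hfun : (fun s : ℝ => f (x + (s : ℂ) • u + (t : ℂ) • v)) = fun s : ℝ => f (x + (t : ℂ) • v + (s : ℂ) • u) := by
      funext s; rw [add_right_comm]
    rw [hfun]
    exact h.deriv
  rw [(Filter.EventuallyEq.deriv_eq hinner : _)]
  exact (hasDerivAt_fderiv_along_line hn hf u v).deriv

end RealLines

/-! ## §12  First order: «`Da` kills the real kernel ⇒ `Da` kills the complex kernel», and the multiplier from «kills `ker L`» + «`L` onto» (the hypothesis `hcrit`) -/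

section RealCrit

variable (cE : E →L⋆[ℂ] E) (cF : F →L⋆[ℂ] F)

/-- **REAL TANGENT-CRITICALITY ⇒ COMPLEX TANGENT-CRITICALITY**: `lam`, `L` conjugation-equivariant (`lam (cE s) = conj (lam s)`, `L (cE s) = cF (L s)`); if `lam` kills every REAL
kernel vector (`cE u = u`, `L u = 0`) then it kills `ker L` (split `s` into fixed and anti-fixed parts; the anti-fixed part is `−I •` a fixed kernel vector).
[cite: Balaban1985Variational, (82)–(83) p.290, p.307; LuenbergerYe2008, §10.7 pp.306–307] -/
theorem killsKer_of_real (hcE : ∀ x, cE (cE x) = x) (lam : E →L[ℂ] ℂ) (L : E →L[ℂ] F)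
    (hL : ∀ s, L (cE s) = cF (L s)) (hreal : ∀ u : E, cE u = u → L u = 0 → lam u = 0) :
    ∀ s : E, L s = 0 → lam s = 0 := by
  intro s hs
  have hcs : L (cE s) = 0 := by rw [hL, hs, map_zero]
  have huK : L ((2 : ℂ)⁻¹ • (s + cE s)) = 0 := by rw [map_smul, map_add, hs, hcs, add_zero, smul_zero]
  have hwK : L ((2 : ℂ)⁻¹ • (s - cE s)) = 0 := by rw [map_smul, map_sub, hs, hcs, sub_zero, smul_zero]
  have hu := hreal _ (conj_fix_rePart cE hcE s) huK
  have hIw := hreal _ (fixed_I_smul_of_antifixed cE (antifixed_half_sub cE hcE s)) (by rw [map_smul, hwK, smul_zero])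
  rw [map_smul, smul_eq_zero] at hIw
  have hw : lam ((2 : ℂ)⁻¹ • (s - cE s)) = 0 := by
    rcases hIw with h | h
    · exact absurd h Complex.I_ne_zero
    · exact h
  rw [← half_add_add_half_sub cE s, map_add, hu, hw, add_zero]

variable [FiniteDimensional ℂ F]

/-- **THE MULTIPLIER**: a continuous linear functional `lam` killing `ker L`, with `L` ONTO a finite-dimensional space, factors as `lam = ℓ₀ ∘ L` — the Lagrange form `hcrit` from
tangent-form criticality + «onto». [cite: LuenbergerYe2008, §10.7 pp.306–307, §11.3 (first-order necessary conditions, regular point); Balaban1985Variational, (82) p.290] -/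
theorem exists_multiplier_of_killsKer (lam : E →L[ℂ] ℂ) (L : E →L[ℂ] F) (honto : Function.Surjective L)
    (hker : ∀ s : E, L s = 0 → lam s = 0) : ∃ ℓ₀ : F →L[ℂ] ℂ, lam = ℓ₀.comp L := by
  classical
  -- a linear right inverse of `L` (finite-dimensional target: choose preimages of a basis)
  obtain ⟨R, hR⟩ : ∃ R : F →ₗ[ℂ] E, (L : E →ₗ[ℂ] F).comp R = LinearMap.id :=
    (L : E →ₗ[ℂ] F).exists_rightInverse_of_surjective (LinearMap.range_eq_top.2 honto)
  refine ⟨LinearMap.toContinuousLinearMap ((lam : E →ₗ[ℂ] ℂ).comp R), ?_⟩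
  ext s
  -- `s - R (L s) ∈ ker L`, so `lam s = lam (R (L s))`
  have hk : L (s - R (L s)) = 0 := by
    have h := LinearMap.congr_fun hR (L s)
    simp only [LinearMap.coe_comp, Function.comp_apply, LinearMap.id_coe, id_eq, ContinuousLinearMap.coe_coe] at h
    rw [map_sub, h, sub_self]
  have h := hker _ hk
  rw [map_sub, sub_eq_zero] at h
  simpa using h

end RealCrit

end Literature.Analysis.Calculus.ConstrainedCriticalFamily

end
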